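import Summits.HodgeConjecture.HodgeConjecture.Theses.PadicSemiregularLift
import Literature.AlgebraicGeometry.HodgeTheory.SemiregularityObstructionBridge

/-!
# `PadicPridhamSemiregularity` (stmt-HodgeConjecture-13815) · Negative · audit of the registered stubs

Negative-side knowledge for the informal crux `PadicSemiregularLift.PadicPridhamSemiregularity` (P1b),
extracted from `Cruxes/PadicPridhamSemiregularity/Disproof.lean` §10 (refuter-cdisprove-stmt-HodgeConjecture-
13815-g3-0, cycle 3, 2026-08-16). Companion of `Negative/StepDatumReduction.lean`.

* `conormalStep_injective_of_torsionFree` / `conormalStep_false_without_torsionFree`: the affine content of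
  line A's stub G3 (`conormalSheaf (X_{n+1} ↪ X_{n+2}) ≅ j_*𝒪_{X_k}`, i.e. `𝒪/p ⥲ p^{n+1}𝒪/p^{n+2}𝒪`) holds
  exactly when `𝒪_𝒳` has no `p`-torsion — flatness (smoothness) is load-bearing there (`𝒳 = Spec k` kills
  it).
* `isZeroOneSemiregularOfIso_of_natural`: line A's stub T (`{0,1}`-semiregularity transports along
  `E ≅ E'`) is exactly naturality of the real `σ₀ = Tr`, `σ₁ = Tr(At ∘ −)` under isomorphisms, read on the
  obstruction groups.
* `exists_liftInvariant_of_hasStepDatum`: the real shadow of line B's one-step datum — `σᵢ ∘ ob` is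
  lift-INVARIANT over all finite locally free lifts `(F, α)` of `E₁` to `X_{n+1}`. On the Godeaux–Serre
  model (`H²(𝒳,𝒪)[p] ≠ 0`), `n = 1`, `E₁ = 𝒪`: `ob(𝒪_{X₂}) = 0 ≠ ob(M_a)` with `σ₀ = Tr` injective in rank one,
  so `stub_deepSteps` is false without Hodge-torsion-freeness (load-bearing there, not in `stub_firstStep`).
-/

noncomputable section

namespace Summit.HodgeConjecture.HodgeConjecture.Theorems.PadicPridhamSemiregularity.Negative

open CategoryTheory CategoryTheory.Limits AlgebraicGeometry
open Literature.AlgebraicGeometry.KTheory Literature.AlgebraicGeometry.Motives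
  Literature.AlgebraicGeometry.Motives.WittScheme Literature.AlgebraicGeometry.HodgeTheory
  Literature.AlgebraicGeometry.Deformation Literature.AlgebraicGeometry.Modules

universe u

/-! ## Line A, stub G3: flatness is load-bearing (affine model of the conormal identification) -/

/-- On an affine `Spec A ⊂ 𝒳` the map `𝒪_𝒳/p → p^{n+1}𝒪_𝒳/p^{n+2}𝒪_𝒳`, `a ↦ p^{n+1}a`, behind
`conormalSheaf (X_{n+1} ↪ X_{n+2}) ≅ j_*𝒪_{X₁}` is injective when `A` has no `p`-torsion (smooth ⇒ flat
over `W`). [folklore] -/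
theorem conormalStep_injective_of_torsionFree {A : Type*} [CommRing A] (p : A)
    (htf : ∀ a : A, p * a = 0 → a = 0) (n : ℕ) (a b : A)
    (h : p ^ (n + 1) * a = p ^ (n + 2) * b) : a = p * b := by
  have key : ∀ m : ℕ, ∀ c : A, p ^ m * c = 0 → c = 0 := by
    intro m
    induction m with
    | zero => intro c hc; simpa using hc
    | succ m ih =>
      intro c hc
      apply ih
      apply htf
      rw [← mul_assoc, ← pow_succ']
      · exact hc
  have h' : p ^ (n + 1) * (a - p * b) = 0 := by
    rw [mul_sub, h, pow_succ, mul_assoc, sub_self]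
  exact sub_eq_zero.mp (key (n + 1) (a - p * b) h')

/-- … and it fails without `p`-torsion-freeness (the non-flat `W`-algebra `A = k`, `𝒳 = Spec k`):
witness `A = ZMod 2`, `p = 2 = 0`, `a = 1 ∉ pA`. [folklore] -/
theorem conormalStep_false_without_torsionFree :
    ¬ ∀ (A : Type) [CommRing A] (p : A) (n : ℕ) (a b : A),
        p ^ (n + 1) * a = p ^ (n + 2) * b → ∃ c : A, a = p * c := by
  intro h
  obtain ⟨c, hc⟩ := h (ZMod 2) 0 0 1 0 (by decide)
  rw [zero_mul] at hc
  exact one_ne_zero hc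

/-! ## Line A, stub T = naturality of the real `σ₀`, `σ₁` under isomorphisms -/

/-- Naturality of `σ₀`, `σ₁` under `e : E ≅ E'` (read on the obstruction groups through
`Deformation.obstructionGroupCongr`) implies line A's stub T verbatim: `{0,1}`-semiregularity transports
along isomorphisms. [folklore] -/
theorem isZeroOneSemiregularOfIso_of_natural
    (hN : ∀ (S : Type) [CommRing S] (Y : SchemeOver S) (E E' : Y.left.Modules) (e : E ≅ E')
      (hE : IsFiniteLocallyFree E) (hE' : IsFiniteLocallyFree E')
      (x : obstructionGroup 2 E (unitModule Y.left)),
      sigmaZeroObstruction hE' (obstructionGroupCongr 2 e (unitModule Y.left) x) =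
          sigmaZeroObstruction hE x ∧
        sigmaOneObstruction hE' (obstructionGroupCongr 2 e (unitModule Y.left) x) =
          sigmaOneObstruction hE x) :
    ∀ (S : Type) [CommRing S] (Y : SchemeOver S) (E E' : Y.left.Modules) (_e : E ≅ E')
      (hE : IsFiniteLocallyFree E) (hE' : IsFiniteLocallyFree E'),
      IsZeroOneSemiregular hE → IsZeroOneSemiregular hE' := by
  intro S _ Y E E' e hE hE' hsr
  rw [isZeroOneSemiregular_iff_obstruction] at hsr ⊢
  intro o h0 h1
  set x := (obstructionGroupCongr 2 e (unitModule Y.left)).symm o with hx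
  have ho : o = obstructionGroupCongr 2 e (unitModule Y.left) x := by
    rw [hx, AddEquiv.apply_symm_apply]
  rw [ho] at h0 h1
  rw [(hN S Y E E' e hE hE' x).1] at h0
  rw [(hN S Y E E' e hE hE' x).2] at h1
  have hx0 : x = 0 := hsr x h0 h1
  rw [ho, hx0, map_zero]

section Witt

variable {p : ℕ} [Fact p.Prime] {k : Type} [Field k] [CharP k p]

/-- **The real shadow of the datum: lift-INVARIANCE of `σ ∘ ob`.** Any one-step datum (hypothesis, line B's
`HasStepDatum` verbatim) yields an obstruction with the lifting criterion whose `σ₀`- and `σ₁`-values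
agree on ALL finite locally free lifts `(F, α)` of `E₁` to `X_{n+1}`. On the Godeaux–Serre model
(`H²(𝒳,𝒪)[p] ≠ 0`), `n = 1`, `E₁ = 𝒪`: `ob(𝒪_{X₂}) = 0 ≠ ob(M_a)` while `σ₀ = Tr` is injective in rank one —
so `stub_deepSteps` is false without Hodge-torsion-freeness, which therefore is load-bearing there (and,
by `hasStepDatum_zero_of_additivePackage`, not in `stub_firstStep`). [folklore] -/
theorem exists_liftInvariant_of_hasStepDatum (𝒳 : SchemeOver (WittVector p k)) (n : ℕ)
    {E₁ : (specialFibre 𝒳).left.Modules} {hE₁ : IsFiniteLocallyFree E₁}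
    (h : ∃ (δ₀ : (KZero.map (specialFibreToThickening 𝒳 n)).range →+
          structureSheafCohomology (specialFibre 𝒳).left 2)
      (δ₁ : (KZero.map (specialFibreToThickening 𝒳 n)).range →+ hodgeCohomologyOne (specialFibre 𝒳) 3)
      (ob : ∀ (F : (WittScheme.thickening 𝒳 (n + 1)).left.Modules), IsFiniteLocallyFree F →
          ((Scheme.Modules.pullback (specialFibreToThickening 𝒳 n)).obj F ≅ E₁) →
          obstructionGroup 2 E₁ (unitModule (specialFibre 𝒳).left))
      (ε₀ ε₁ : ℤˣ),
      (∀ x : (KZero.map (specialFibreToThickening 𝒳 n)).range,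
        (∃ y : KZero (WittScheme.thickening 𝒳 (n + 2)).left,
          KZero.map (specialFibreToThickening 𝒳 (n + 1)) y = x.1) → δ₀ x = 0 ∧ δ₁ x = 0) ∧
      (∀ (F : (WittScheme.thickening 𝒳 (n + 1)).left.Modules) (hF : IsFiniteLocallyFree F)
          (α : (Scheme.Modules.pullback (specialFibreToThickening 𝒳 n)).obj F ≅ E₁),
        ob F hF α = 0 ↔ ∃ F' : (WittScheme.thickening 𝒳 (n + 2)).left.Modules, IsFiniteLocallyFree F' ∧
          Nonempty ((Scheme.Modules.pullback (thickeningMap 𝒳 (Nat.le_succ (n + 1)))).obj F' ≅ F)) ∧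
      (∀ (F : (WittScheme.thickening 𝒳 (n + 1)).left.Modules) (hF : IsFiniteLocallyFree F)
          (α : (Scheme.Modules.pullback (specialFibreToThickening 𝒳 n)).obj F ≅ E₁)
          (hx : KZero.of E₁ hE₁ ∈ (KZero.map (specialFibreToThickening 𝒳 n)).range),
        δ₀ ⟨KZero.of E₁ hE₁, hx⟩ = ε₀ • sigmaZeroObstruction hE₁ (ob F hF α) ∧
        δ₁ ⟨KZero.of E₁ hE₁, hx⟩ = ε₁ • sigmaOneObstruction hE₁ (ob F hF α))) :
    ∃ ob : ∀ (F : (WittScheme.thickening 𝒳 (n + 1)).left.Modules), IsFiniteLocallyFree F →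
        ((Scheme.Modules.pullback (specialFibreToThickening 𝒳 n)).obj F ≅ E₁) →
        obstructionGroup 2 E₁ (unitModule (specialFibre 𝒳).left),
      (∀ (F : (WittScheme.thickening 𝒳 (n + 1)).left.Modules) (hF : IsFiniteLocallyFree F)
          (α : (Scheme.Modules.pullback (specialFibreToThickening 𝒳 n)).obj F ≅ E₁),
        ob F hF α = 0 ↔ ∃ F' : (WittScheme.thickening 𝒳 (n + 2)).left.Modules, IsFiniteLocallyFree F' ∧
          Nonempty ((Scheme.Modules.pullback (thickeningMap 𝒳 (Nat.le_succ (n + 1)))).obj F' ≅ F)) ∧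
      ∀ (F F' : (WittScheme.thickening 𝒳 (n + 1)).left.Modules) (hF : IsFiniteLocallyFree F)
        (hF' : IsFiniteLocallyFree F')
        (α : (Scheme.Modules.pullback (specialFibreToThickening 𝒳 n)).obj F ≅ E₁)
        (α' : (Scheme.Modules.pullback (specialFibreToThickening 𝒳 n)).obj F' ≅ E₁),
        sigmaZeroObstruction hE₁ (ob F hF α) = sigmaZeroObstruction hE₁ (ob F' hF' α') ∧
          sigmaOneObstruction hE₁ (ob F hF α) = sigmaOneObstruction hE₁ (ob F' hF' α') := by
  obtain ⟨δ₀, δ₁, ob, ε₀, ε₁, -, hob, hid⟩ := h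
  refine ⟨ob, hob, fun F F' hF hF' α α' => ?_⟩
  have hx : KZero.of E₁ hE₁ ∈ (KZero.map (specialFibreToThickening 𝒳 n)).range :=
    ⟨KZero.of F hF, by rw [KZero.map_of]; exact KZero.of_iso α _ _⟩
  obtain ⟨h0, h1⟩ := hid F hF α hx
  obtain ⟨h0', h1'⟩ := hid F' hF' α' hx
  exact ⟨MulAction.injective ε₀ (h0.symm.trans h0'), MulAction.injective ε₁ (h1.symm.trans h1')⟩

end Witt

end Summit.HodgeConjecture.HodgeConjecture.Theorems.PadicPridhamSemiregularity.Negative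

end
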